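import Summits.ResolutionOfSingularities.ResolutionOfSingularities.Theorems.PurelyInseparableDim4ChartAtlasSNCFarChartPairs
import Summits.ResolutionOfSingularities.ResolutionOfSingularities.Theorems.PurelyInseparableDim4ChartAtlasSNCFarShearPairs
import Summits.ResolutionOfSingularities.ResolutionOfSingularities.Theorems.PurelyInseparableDim4ChartAtlasSNCGoodFarEscapingCharts
import HarnessLib

/-!
# Purely inseparable four-folds `z^p + F(x₁, …, x₄)`: NEAR/TRANSVERSAL PAIR-LIST BOUNDARIES on the charts of the escaping atlas — the chart
# pieces of the case `j ∈ S'` (cell `res-dim4-pi`, typ-2 g6)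

[OURS · counted 0] (D-0157 DOOR 2; DR-157-C; typ-2 HANDOFF OPEN item «`j ∈ S'` pair-list version»). When the escaping direction `j` lies in the
new centre (`j ∈ S'`), the strict transforms of the FAR members `{xᵢ = -d}` (`i ∈ S`, `d ≠ 0`) never meet the global centre `Zc`
(p699951 `support_strictTransform_far_inter_support_globalCentre`), so only the NEAR (`(i, 0)`, `i ∈ S`) and TRANSVERSAL (`(k, c)`, `k ∉ S`)
members of a pair list `L : List (Fin 4 × K)` have to be read on the charts. PROVED here (no `sorry`, no new axiom), for lists WITHOUT far
members:

* `hasSNCWith_boundary_readings_translate_chart_near_pairs` — on the re-centred `x_j`-chart every member reads `⊤` or a translated coordinate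
  hyperplane, so the readings are snc with `V(y_0, y_Λ)` for EVERY `Λ` (p709429 `hasSNCWith_𝓘Λ_hyperplanes_pairs`);
* `hasSNCWith_boundary_readings_shear_chart_near_pairs` — on a shear chart `x_l` (`l ∈ S`, `l ≠ j`) the readings (hyperplanes, sheared
  near members `(y_m + b_m·y_j)·𝒪`, the exceptional `(y_l)·𝒪`) are snc with `V(y_0, y_T)` for every `T ∌ j` under `|B_near| ≤ 1` read
  against `T` off `{j, l}` (p709808's indexed engine with no far family); `T = S'` is the escaping case, `T = {l} ∪ (S' ∖ j)` the case
  `j ∈ S'` (p699951 `exists_shear_chart_reading_of_mem`).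

Nothing here is a statement about resolution of singularities in dimension ≥ 4 / characteristic `p` (NOT proved anywhere in this programme).
bears_on: LADDER-RESOLUTION:D157-DOOR2 (res-dim4-pi). Supports stmt-ResolutionOfSingularities-16155 (helper, S3-N2 positive side).
-/

-- every declaration of this summit lives under `Summit.ResolutionOfSingularities.ResolutionOfSingularities`
-- (summit = problem), which the duplicate-namespace linter flags; house convention (cf. the Target file).
set_option linter.dupNamespace false

noncomputable section

open MvPolynomial Finset CategoryTheory AlgebraicGeometry Opposite TopologicalSpace
open AlgebraicGeometry.Scheme.IdealSheafData (ofIdealTop vanishingIdeal)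

namespace Summit.ResolutionOfSingularities.ResolutionOfSingularities.Theorems.PIDim4

open Literature.AlgebraicGeometry.Resolution
open Literature.AlgebraicGeometry.Resolution.AffinePointBlowup (P A γ coord)

namespace ChartDictionary

variable {K : Type} [Field K]

section TranslateChart

variable {S : Finset (Fin 4)} {j : Fin 4} {b : Fin 4 → K} {Θ : A 4 K ≃ₐ[K] A 4 K} {W : Scheme.{0}} {π : W ⟶ P 4 K}

/-- **NEAR/TRANSVERSAL PAIR-LIST BOUNDARY ON THE RE-CENTRED `x_j`-CHART: snc with `V(y_0, y_Λ)` for EVERY `Λ`.** Without far members every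
member `(i, c) ∈ L` reads `⊤` (`i = j`) or a translated coordinate hyperplane (`(yᵢ + bᵢ)·𝒪` near, `(y_k + b_k + c)·𝒪` transversal), and
the exceptional divisor reads `(y_j)·𝒪`. -/
theorem hasSNCWith_boundary_readings_translate_chart_near_pairs (hj : j ∈ S) (hbj : b j = 0) (L : List (Fin 4 × K))
    (hL : ∀ ic ∈ L, ic.1 ∈ S → ic.2 = 0) (hs : ∀ i : Fin 4, Θ (X i.succ) = X i.succ + C (b i))
    (hπ : IsBlowup π (AffineCoordBlowup.𝓘Λ 4 K (insert 0 (Fin.succ '' (S : Set (Fin 4)))))) (Λ : Set (Fin (4 + 1))) :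
    haveI : IsIso (CommRingCat.ofHom (Θ : A 4 K →+* A 4 K)) := (inferInstance : IsIso Θ.toRingEquiv.toCommRingCatIso.hom)
    HasSNCWith (((L.map fun ic => ofIdealTop (Ideal.span {(γ 4 K).symm (X ic.1.succ + C ic.2)})).map
        (strictTransformIdeal π (AffineCoordBlowup.𝓘Λ 4 K (insert 0 (Fin.succ '' (S : Set (Fin 4)))))) ++
        [(AffineCoordBlowup.𝓘Λ 4 K (insert 0 (Fin.succ '' (S : Set (Fin 4))))).comap π]).map
        (·.comap (Spec.map (CommRingCat.ofHom (Θ : A 4 K →+* A 4 K)) ≫ AffineCoordBlowup.chartImm hπ (succ_mem_centreVars hj))))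
      (AffineCoordBlowup.𝓘Λ 4 K Λ) := by
  classical
  haveI : IsIso (CommRingCat.ofHom (Θ : A 4 K →+* A 4 K)) := (inferInstance : IsIso Θ.toRingEquiv.toCommRingCatIso.hom)
  -- hyperplane data: `E₁ = (j⁺, 0)`; near `i ∈ S ∖ j` ↦ `(i⁺, bᵢ)`; transversal `i ∉ S` ↦ `(i⁺, bᵢ + c)`
  let H : Finset (Fin (4 + 1) × K) := insert (j.succ, (0 : K))
    (((L.toFinset.filter fun ic => ic.1 ∈ S ∧ ic.1 ≠ j).image fun ic => (ic.1.succ, b ic.1)) ∪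
      ((L.toFinset.filter fun ic => ic.1 ∉ S).image fun ic => (ic.1.succ, b ic.1 + ic.2)))
  refine hasSNCWith_𝓘Λ_hyperplanes_pairs Λ H fun D hD => ?_
  rw [List.map_append, List.map_map, List.map_map, List.mem_append, List.mem_map, List.map_singleton, List.mem_singleton] at hD
  rcases hD with ⟨ic, hic, rfl⟩ | rfl
  · simp only [Function.comp_apply]
    by_cases hij : ic.1 = j
    · left
      have hc : ic.2 = 0 := hL ic hic (by rw [hij]; exact hj)
      have e1 : ic = (j, 0) := Prod.ext hij hc
      rw [e1, C_0, add_zero, Scheme.IdealSheafData.comap_comp, show (γ 4 K).symm (X j.succ) = coord 4 K j.succ from rfl,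
        strictTransformIdeal_hyperplane_self_comap_chartImm hj hπ, Scheme.IdealSheafData.comap_top]
    · by_cases hiS : ic.1 ∈ S
      · right
        have hc : ic.2 = 0 := hL ic hic hiS
        refine ⟨(ic.1.succ, b ic.1), Finset.mem_insert_of_mem (Finset.mem_union_left _
          (Finset.mem_image.mpr ⟨ic, Finset.mem_filter.mpr ⟨List.mem_toFinset.mpr hic, hiS, hij⟩, rfl⟩)), ?_⟩
        rw [hc, C_0, add_zero, Scheme.IdealSheafData.comap_comp, show (γ 4 K).symm (X ic.1.succ) = coord 4 K ic.1.succ from rfl,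
          strictTransformIdeal_hyperplane_comap_chartImm hj hij hπ, show coord 4 K ic.1.succ = (γ 4 K).symm (X ic.1.succ) from rfl,
          comap_ofIdealTop_span_γ_symm, RingHom.coe_coe, hs ic.1]
      · right
        refine ⟨(ic.1.succ, b ic.1 + ic.2), Finset.mem_insert_of_mem (Finset.mem_union_right _
          (Finset.mem_image.mpr ⟨ic, Finset.mem_filter.mpr ⟨List.mem_toFinset.mpr hic, hiS⟩, rfl⟩)), ?_⟩
        have hC : Θ (C ic.2) = C ic.2 := Θ.commutes ic.2
        rw [Scheme.IdealSheafData.comap_comp, strictTransformIdeal_translate_comap_chartImm hj hiS ic.2 hπ, comap_ofIdealTop_span_γ_symm,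
          RingHom.coe_coe, map_add, hs ic.1, hC, add_assoc, ← C_add]
  · right
    refine ⟨(j.succ, 0), Finset.mem_insert_self _ _, ?_⟩
    rw [Scheme.IdealSheafData.comap_comp, comap_𝓘Λ_chartImm hj hπ, show coord 4 K j.succ = (γ 4 K).symm (X j.succ) from rfl,
      comap_ofIdealTop_span_γ_symm, RingHom.coe_coe, hs j, hbj]

end TranslateChart

section ShearChart

variable {S T : Finset (Fin 4)} {j l : Fin 4} {b : Fin 4 → K} {Θ : A 4 K ≃ₐ[K] A 4 K}
  {τ : MvPolynomial (Fin 4) K ≃ₐ[K] MvPolynomial (Fin 4) K} {W : Scheme.{0}} {π : W ⟶ P 4 K}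

/-- **NEAR/TRANSVERSAL PAIR-LIST BOUNDARY ON A SHEAR CHART `x_l` (`l ∈ S`, `l ≠ j`): snc with `V(y_0, y_T)` for every `T ∌ j`** under
`|B_near| ≤ 1` read against `T` off `{j, l}`: `(j, 0) ∈ L ⟹` no near `(m, 0) ∈ L`, `m ∈ (S ∩ T) ∖ {j, l}`, with `b_m ≠ 0`; at most one
such `m`. (`T = S'` is the escaping case `j ∉ S'`; `T = {l} ∪ (S' ∖ j)` the case `j ∈ S'`.) -/
theorem hasSNCWith_boundary_readings_shear_chart_near_pairs (hl : l ∈ S) (hj : j ∈ S) (hjl : j ≠ l) (hjT : j ∉ T)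
    (L : List (Fin 4 × K)) (hL : ∀ ic ∈ L, ic.1 ∈ S → ic.2 = 0)
    (hτ : ∀ k : Fin 4, Θ (X k.succ) = rename Fin.succ (τ (X k))) (hτj : τ (X j) = X j) (hτl : τ (X l) = X l)
    (hτS : ∀ i ∈ S, i ≠ j → i ≠ l → τ (X i) = X i + C (b i) * X j) (hτk : ∀ k ∉ S, τ (X k) = X k + C (b k))
    (hB1 : (j, (0 : K)) ∈ L → ∀ mc ∈ L, mc.1 ∈ S → mc.1 ≠ j → mc.1 ≠ l → mc.1 ∈ T → mc.2 = 0 → b mc.1 = 0)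
    (hB2 : ∀ mc ∈ L, ∀ mc' ∈ L, mc.1 ∈ S → mc'.1 ∈ S → mc.1 ≠ l → mc'.1 ≠ l → mc.1 ∈ T → mc'.1 ∈ T → mc.2 = 0 → mc'.2 = 0 →
      b mc.1 ≠ 0 → b mc'.1 ≠ 0 → mc.1 = mc'.1)
    (hπ : IsBlowup π (AffineCoordBlowup.𝓘Λ 4 K (insert 0 (Fin.succ '' (S : Set (Fin 4)))))) :
    haveI : IsIso (CommRingCat.ofHom (Θ : A 4 K →+* A 4 K)) := (inferInstance : IsIso Θ.toRingEquiv.toCommRingCatIso.hom)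
    HasSNCWith (((L.map fun ic => ofIdealTop (Ideal.span {(γ 4 K).symm (X ic.1.succ + C ic.2)})).map
        (strictTransformIdeal π (AffineCoordBlowup.𝓘Λ 4 K (insert 0 (Fin.succ '' (S : Set (Fin 4)))))) ++
        [(AffineCoordBlowup.𝓘Λ 4 K (insert 0 (Fin.succ '' (S : Set (Fin 4))))).comap π]).map
        (·.comap (Spec.map (CommRingCat.ofHom (Θ : A 4 K →+* A 4 K)) ≫ AffineCoordBlowup.chartImm hπ (succ_mem_centreVars hl))))
      (AffineCoordBlowup.𝓘Λ 4 K (insert 0 (Fin.succ '' (T : Set (Fin 4))))) := by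
  classical
  haveI : IsIso (CommRingCat.ofHom (Θ : A 4 K →+* A 4 K)) := (inferInstance : IsIso Θ.toRingEquiv.toCommRingCatIso.hom)
  -- hyperplanes: `E₁ = (l⁺, 0)`; old `{x_j = 0}` ↦ `(j⁺, 0)`; near `(i, 0)`, `i ∈ S ∖ {j, l}`, `bᵢ = 0` ↦ `(i⁺, 0)`; transversal `(i, c)`,
  -- `i ∉ S` ↦ `(i⁺, bᵢ + c)`; near members with `bᵢ ≠ 0` are SHEARED: `(yᵢ + bᵢ y_j)·𝒪`
  let H : Finset (Fin (4 + 1) × K) := insert (l.succ, (0 : K))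
    (((L.toFinset.filter fun ic => ic = (j, 0)).image fun _ => (j.succ, (0 : K))) ∪
      ((L.toFinset.filter fun ic => ic.1 ∈ S ∧ ic.1 ≠ j ∧ ic.1 ≠ l ∧ b ic.1 = 0).image fun ic => (ic.1.succ, (0 : K))) ∪
      ((L.toFinset.filter fun ic => ic.1 ∉ S).image fun ic => (ic.1.succ, b ic.1 + ic.2)))
  let sh : Finset (Fin 4) := (L.toFinset.filter fun ic => ic.1 ∈ S ∧ ic.1 ≠ j ∧ ic.1 ≠ l ∧ b ic.1 ≠ 0).image Prod.fst
  have hHmem : ∀ ka, ka ∈ H → ka = (l.succ, (0 : K)) ∨ ((j, (0 : K)) ∈ L ∧ ka = (j.succ, 0)) ∨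
      (∃ i, (i, (0 : K)) ∈ L ∧ i ∈ S ∧ i ≠ j ∧ i ≠ l ∧ b i = 0 ∧ ka = (i.succ, 0)) ∨
      ∃ ic ∈ L, ic.1 ∉ S ∧ ka = (ic.1.succ, b ic.1 + ic.2) := by
    intro ka hka
    simp only [H, Finset.mem_insert, Finset.mem_union, Finset.mem_image, Finset.mem_filter, List.mem_toFinset] at hka
    rcases hka with h | ((⟨ic, ⟨hic, hj0⟩, rfl⟩ | ⟨ic, ⟨hic, hiS, hij, hil, hb0⟩, rfl⟩) | ⟨ic, ⟨hic, hiS⟩, rfl⟩)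
    · exact Or.inl h
    · exact Or.inr (Or.inl ⟨hj0 ▸ hic, rfl⟩)
    · refine Or.inr (Or.inr (Or.inl ⟨ic.1, ?_, hiS, hij, hil, hb0, rfl⟩))
      rw [← hL ic hic hiS]
      exact hic
    · exact Or.inr (Or.inr (Or.inr ⟨ic, hic, hiS, rfl⟩))
  have hsh : ∀ m, m ∈ sh ↔ (m, (0 : K)) ∈ L ∧ m ∈ S ∧ m ≠ j ∧ m ≠ l ∧ b m ≠ 0 := by
    intro m
    simp only [sh, Finset.mem_image, Finset.mem_filter, List.mem_toFinset]
    constructor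
    · rintro ⟨ic, ⟨hic, hiS, hij, hil, hb⟩, rfl⟩
      exact ⟨by rw [← hL ic hic hiS]; exact hic, hiS, hij, hil, hb⟩
    · rintro ⟨hm, hmS, hmj, hml, hb⟩
      exact ⟨(m, 0), ⟨hm, hmS, hmj, hml, hb⟩, rfl⟩
  refine hasSNCWith_𝓘Λ_of_forall_mem_far_shear_pairs (K := K) (T := T) (j := j) (l := l) (b := b) hjT hjl H sh ∅ ∅
    (fun h => ((hsh j).mp h).2.2.1 rfl) (fun h => ((hsh l).mp h).2.2.2.1 rfl) (fun m hm => ((hsh m).mp hm).2.2.2.2)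
    (fun _ h => absurd h (Finset.notMem_empty _)) (fun _ h => absurd h (Finset.notMem_empty _)) ?_ ?_
    (fun _ h => absurd h (Finset.notMem_empty _)) ?_ ?_ (fun _ h => absurd h (Finset.notMem_empty _))
    (fun _ h => absurd h (Finset.notMem_empty _)) ?_
  · -- hyperplanes of index `j` have constant `0`
    intro a ha
    rcases hHmem _ ha with e | ⟨-, e⟩ | ⟨i, -, -, hij, -, -, e⟩ | ⟨ic, -, hicS, e⟩
    · exact absurd (Fin.succ_injective _ (Prod.mk.inj e).1) hjl
    · exact (Prod.mk.inj e).2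
    · exact absurd (Fin.succ_injective _ (Prod.mk.inj e).1).symm hij
    · exact absurd ((Fin.succ_injective _ (Prod.mk.inj e).1) ▸ hj) hicS
  · -- no hyperplane of a sheared index
    intro m hm a ha
    obtain ⟨-, hmS, hmj, hml, hbm⟩ := (hsh m).mp hm
    rcases hHmem _ ha with e | ⟨-, e⟩ | ⟨i, -, -, -, -, hb0, e⟩ | ⟨ic, -, hicS, e⟩
    · exact hml (Fin.succ_injective _ (Prod.mk.inj e).1)
    · exact hmj (Fin.succ_injective _ (Prod.mk.inj e).1)
    · exact hbm ((Fin.succ_injective _ (Prod.mk.inj e).1) ▸ hb0)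
    · exact hicS ((Fin.succ_injective _ (Prod.mk.inj e).1) ▸ hmS)
  · -- `{x_j = 0}` old ⟹ nothing sheared into the centre
    intro hmem m hm hmT
    obtain ⟨hmL, hmS, hmj, hml, hbm⟩ := (hsh m).mp hm
    have hj0 : (j, (0 : K)) ∈ L := by
      rcases hHmem _ hmem with e | ⟨h, -⟩ | ⟨i, -, -, hij, -, -, e⟩ | ⟨ic, -, hicS, e⟩
      · exact absurd (Fin.succ_injective _ (Prod.mk.inj e).1) hjl
      · exact h
      · exact absurd (Fin.succ_injective _ (Prod.mk.inj e).1).symm hij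
      · exact absurd ((Fin.succ_injective _ (Prod.mk.inj e).1) ▸ hj) hicS
    exact hbm (hB1 hj0 (m, 0) hmL hmS hmj hml hmT rfl)
  · -- at most one member sheared into the centre
    intro m hm m' hm' hmT hm'T
    obtain ⟨hmL, hmS, -, hml, hbm⟩ := (hsh m).mp hm
    obtain ⟨hm'L, hm'S, -, hm'l, hbm'⟩ := (hsh m').mp hm'
    exact hB2 (m, 0) hmL (m', 0) hm'L hmS hm'S hml hm'l hmT hm'T rfl rfl hbm hbm'
  · -- the members, read on the chart
    intro D hD
    rw [List.map_append, List.map_map, List.map_map, List.mem_append, List.mem_map, List.map_singleton, List.mem_singleton] at hD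
    rcases hD with ⟨ic, hic, rfl⟩ | rfl
    · simp only [Function.comp_apply]
      by_cases hil : ic.1 = l
      · left
        have hc : ic.2 = 0 := hL ic hic (by rw [hil]; exact hl)
        have e1 : ic = (l, 0) := Prod.ext hil hc
        rw [e1, C_0, add_zero, show (γ 4 K).symm (X l.succ) = coord 4 K l.succ from rfl]
        exact comap_shear_chart_strictTransform_hyperplane_self hl _ hπ
      · by_cases hij : ic.1 = j
        · right; left
          have hc : ic.2 = 0 := hL ic hic (by rw [hij]; exact hj)
          have e1 : ic = (j, 0) := Prod.ext hij hc
          refine ⟨(j.succ, 0), Finset.mem_insert_of_mem (Finset.mem_union_left _ (Finset.mem_union_left _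
            (Finset.mem_image.mpr ⟨ic, Finset.mem_filter.mpr ⟨List.mem_toFinset.mpr hic, e1⟩, rfl⟩))), ?_⟩
          rw [e1, C_0, add_zero, show (γ 4 K).symm (X j.succ) = coord 4 K j.succ from rfl]
          exact comap_shear_chart_strictTransform_hyperplane_j hl hjl hτ hτj hπ
        · by_cases hiS : ic.1 ∈ S
          · have hc : ic.2 = 0 := hL ic hic hiS
            by_cases hb0 : b ic.1 = 0
            · right; left
              refine ⟨(ic.1.succ, 0), Finset.mem_insert_of_mem (Finset.mem_union_left _ (Finset.mem_union_right _
                (Finset.mem_image.mpr ⟨ic, Finset.mem_filter.mpr ⟨List.mem_toFinset.mpr hic, hiS, hij, hil, hb0⟩, rfl⟩))), ?_⟩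
              rw [hc, C_0, add_zero, show (γ 4 K).symm (X ic.1.succ) = coord 4 K ic.1.succ from rfl]
              have h := comap_shear_chart_strictTransform_hyperplane_shear hl hil hτ (hτS ic.1 hiS hij hil) hπ
              rw [hb0, C_0, zero_mul, add_zero] at h
              exact h
            · right; right; left
              refine ⟨ic.1, (hsh _).mpr ⟨by rw [← hc]; exact hic, hiS, hij, hil, hb0⟩, ?_⟩
              rw [hc, C_0, add_zero, show (γ 4 K).symm (X ic.1.succ) = coord 4 K ic.1.succ from rfl]
              exact comap_shear_chart_strictTransform_hyperplane_shear hl hil hτ (hτS ic.1 hiS hij hil) hπ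
          · right; left
            exact ⟨(ic.1.succ, b ic.1 + ic.2), Finset.mem_insert_of_mem (Finset.mem_union_right _
              (Finset.mem_image.mpr ⟨ic, Finset.mem_filter.mpr ⟨List.mem_toFinset.mpr hic, hiS⟩, rfl⟩)),
              comap_shear_chart_strictTransform_translate hl hiS ic.2 hτ (hτk ic.1 hiS) hπ⟩
    · right; left
      exact ⟨(l.succ, 0), Finset.mem_insert_self _ _, comap_shear_chart_exceptional hl hτ hτl hπ⟩

end ShearChart

end ChartDictionary

end Summit.ResolutionOfSingularities.ResolutionOfSingularities.Theorems.PIDim4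

end
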